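import Summits.Ventures.PercRepro.CoreSevenNine
import Summits.Ventures.PercRepro.RankLevelSetCorankFourSharp
import Summits.Ventures.PercRepro.RankLevelSetCorankFiveSharp

/-!
# PercRepro — the `q = 3` row of C-025 reduces to the core cells `p ∈ {7, 8}` (p2, gen 12)

With night-1's `ThmN.c025_three_corank_four_sharp` (every matroid of corank `≤ 4` and rank `≥ 18`) and
`ThmN.c025_core_corank_five_sharp` (the core at corank `5`, `p ≥ 14`), every cell of `SmallCoreCellsNine` other than
`p ∈ {7, 8}` is a tree theorem: C-025 at `(p, 3)` on every finite matroid, for every `p ≥ 5`, follows from the core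
statement at `p = 7` and `p = 8` alone.

* `SmallCoreCellsSevenEight` — the core statement on `p ∈ {7, 8}`;
* `smallCoreCellsNine_of_sevenEight`, **`c025_three_of_sevenEight`**.
Imports `CoreSevenNine`, `RankLevelSetCorankFourSharp`, `RankLevelSetCorankFiveSharp`. Axioms: standard.
-/

namespace PercRepro
namespace CoreFour

/-- **The core statement at `p ∈ {7, 8}`** (the paper theorems `(7,3)`, `(8,3)`). -/
def SmallCoreCellsSevenEight : Prop :=
  ∀ {α : Type} (M : Matroid α) [M.Finite] (p : ℕ), (p = 7 ∨ p = 8) →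
    (∀ e ∈ M.E, ∀ f ∈ M.E, e ≠ f → M.eRk {e, f} = 2) → M.eRank = (p : ℕ∞) →
    (∀ e, ¬ M.IsColoop e) →
    (∀ e ∈ M.E, ∃ A ⊆ M.E \ {e}, e ∉ M.closure A ∧ e ∉ M.closure ((M.E \ {e}) \ A)) →
    ThmN.RLS M p 3

/-- Every cell of `SmallCoreCellsNine` other than `p ∈ {7, 8}` is a tree theorem: corank `4` at `p ≥ 18` and corank
`5` at `p ≥ 14` are night-1's; `p ∈ {5, 6}` at corank `≥ 4` are `(5,3)` / `(6,3)`; no other cell remains. -/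
theorem smallCoreCellsNine_of_sevenEight (h : SmallCoreCellsSevenEight) : SmallCoreCellsNine := by
  intro α M _ p hp hs hrank hcoloop hfree hcell
  rcases hcell with h78 | ⟨hp169, hlo, hhi, h100, h4, h5, h6, h7⟩
  · exact h M p h78 hs hrank hcoloop hfree
  · rcases Nat.lt_or_ge p 9 with hp9 | hp9
    · rcases (show p = 5 ∨ p = 6 ∨ p = 7 ∨ p = 8 by omega) with rfl | rfl | rfl | rfl
      · exact ThmO.c025_five_three_all M
      · classical
        exact SixThree.c025_six_three M
      · exact h M 7 (Or.inl rfl) hs hrank hcoloop hfree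
      · exact h M 8 (Or.inr rfl) hs hrank hcoloop hfree
    · -- `9 ≤ p`: the corank is `4`, `5`, `6` or `7` (`|E| < p + amin p ≤ p + 8`)
      have hamin : CoreRegimes.amin p ≤ 8 := by
        unfold CoreRegimes.amin
        split_ifs <;> omega
      rcases (show M.E.ncard = p + 4 ∨ M.E.ncard = p + 5 ∨ M.E.ncard = p + 6 ∨ M.E.ncard = p + 7 by omega) with
        hE | hE | hE | hE
      · -- corank `4`: `p ≥ 18`
        have hp18 : 18 ≤ p := by
          by_contra hlt
          push Not at hlt
          exact h4 ⟨hE, hp9, by omega⟩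
        exact ThmN.c025_three_corank_four_sharp M p hp18 (by omega)
      · -- corank `5`: `p ≥ 14`
        have hp14 : 14 ≤ p := by
          by_contra hlt
          push Not at hlt
          exact h5 ⟨hE, hp9, by omega⟩
        exact ThmN.c025_core_corank_five_sharp M p hp14 hs hrank hfree hE
      · -- corank `6`: excluded unless `p ≥ 13`, but then `|E| ≥ p + amin p = p + 6`
        exfalso
        rcases Nat.lt_or_ge p 13 with hlt | hge
        · exact h6 ⟨hE, hp9, by omega⟩
        · have : CoreRegimes.amin p = 6 := by
            unfold CoreRegimes.amin; simp [show ¬ p ≤ 9 by omega, show ¬ p ≤ 12 by omega]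
          omega
      · -- corank `7`: only `p = 9` is below `amin`, and that cell is `c025_core_seven_nine`
        exfalso
        rcases Nat.lt_or_ge p 10 with hlt | hge
        · exact h7 ⟨hE, by omega⟩
        · have : CoreRegimes.amin p ≤ 7 := by
            unfold CoreRegimes.amin; split_ifs <;> omega
          omega

/-- **C-025 at `q = 3` on every finite matroid, for every `p ≥ 5`, from the core statement at `p = 7` and `p = 8`.** -/
theorem c025_three_of_sevenEight (h : SmallCoreCellsSevenEight) :
    ∀ {α : Type} (M : Matroid α) [M.Finite] (p : ℕ), 5 ≤ p → ThmN.RLS M p 3 :=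
  c025_three_of_smallCoreCellsNine (smallCoreCellsNine_of_sevenEight h)

end CoreFour
end PercRepro
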